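import Literature.Analysis.FluidPDE.Tao2016AveragedNS.SeedScaleEquipartition
import HarnessLib

/-!
# The gate fires: (toke) and (able) for approximate trajectories at the seed scale

Cell `pub-fluidc`, blueprint seat 1 (gen 13) — last part of the firing analysis for approximate
trajectories (successor option (F2)). HONEST FRAMING: low prior, high value-of-information
experiment on Tao's machine paradigm [Tao2016AveragedNS, §5.5]; NOT a claim that NS blows up.

Setting of SeedScaleEquipartition.lean (differentiable approximate trajectory `Y` of a member
`delayCircuitWith K M ε`, velocity `V`, sup-defect `δ` and sup-norm `≤ 2` on `[0,T)`, `T ≥ 2`,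
datum `δ₀`-close to (5.6), budget `δ₀ + 2δ ≤ ε²e^{-M}/(8√M)`; trigger time `τ`, onset delay `d`,
late window `[·, T']` with `T' < T`, `T' ≤ 2`; `t' := τ + d + 1/K ≤ T'`, where `ã(t') ≥ 1/10` by
(atc)). This file ports the equipartition phase of [Tao2016AveragedNS, §5.5] to such trajectories:

* `Ignition.Es_alg_approx`: the algebra of the `E_*`-dissipation with a PERTURBED energy identity
  `a² + b² + c² + d² + ã² = 1 + η`, `|η| ≤ ε`, an ALMOST-monotone output `ã ≥ ã₀ - ε`, modes `≤ 2`,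
  an output defect `θ₄` and the corrector remainder `|R| ≤ 40K⁻⁹⁰`: `∂ₜE_* + Kã₀E_* ≤ 80K⁻⁸⁹`;
* `Ignition.hasDerivAt_Es`, `Ignition.Es_dissipation_after`, `Ignition.Es_decay_after` — **(toke)**:
  `E_*(t) ≤ e^{(K/10)(t' - t)} + 800K⁻⁹⁰` on `[t', T']`;
* `Ignition.ad_sq_le_after`, `Ignition.fired_after` — **(able)** on `[t' + 1/√K, T']`:
  `|ã - 1| ≤ 4K⁻²⁰`, `|a|, |b|, |c|, |d| ≤ 2K⁻¹⁰`;
* `approxTrajectory_fires` (explicit hypotheses, budget `δ₀ + δT ≤ ε²e^{-M}/(8√M)`): the whole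
  chain — trigger time `τ ∈ (1, 8/5]`, quiet output `|ã| ≤ 4K⁻¹⁰` on `[0, τ]`, and the fired state
  on `[τ + 130 log K/M + 1/K + 1/√K, T']` for every `T' < T`, `T' ≤ 2`; the left end is `< 7/4`;
* `approxTrajectory_fired_at_two`: hence the fired state on `[7/4, 2]` (the end point `t = 2` by
  continuity when `T = 2`).

This is Theorem 5.3 of [Tao2016AveragedNS] for every differentiable approximate trajectory within
the seed-scale budget (in the `HasDerivAt`-everywhere setting of CascadeDefect; the cell's typed
question `PseudoOrbitTransitionSeed q` is stated for right-differentiable pseudo-orbits and is not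
decided here).

Layout note: the lemmas of `section Seed` whose proofs use the budget only through
`budget_facts'` (`δ₀ + 2δ ≤ ε²e^{-M}/8`) are proved under that WEAK budget in `section Eighth` (primed
names) and re-exported with unchanged statements under the seed-scale budget `ε²e^{-M}/(8√M)`, so that
the sharp-budget chain (SeedScaleSharp*.lean) can reuse them.
-/

namespace Literature.Analysis.FluidPDE.Tao2016AveragedNS

open Real Set MeasureTheory
open scoped NNReal
open NegKick (clockInt clockInt_zero)

namespace Ignition

/-! ## §1. The algebra of the `E_*`-dissipation, perturbed -/

/-- **The `E_*`-dissipation algebra for approximate trajectories.** With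
`a² + b² + c² + d² + ã² = 1 + η` (`|η| ≤ ε`), `0 ≤ ã₀ ≤ 2`, `ã ≥ ã₀ - ε`, `|a|, |d|, |ã| ≤ 2`,
`b² + c² ≤ 9ε`, `|θ| ≤ ε`, `|R| ≤ 40K⁻⁹⁰`, `0 ≤ q ≤ K⁻¹⁰⁰`, `ε ≤ K⁻¹⁰⁰` (`V = adq`):
`-ã(Kd² + θ) - ½K((a² - d² + R)ã + V(Kd² + θ)) + Kã₀(½(1 - ã²) - ½KVã) ≤ 80K⁻⁸⁹`.
[cite: Tao2016AveragedNS, §5.5 (proof of (beable))] -/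
theorem Es_alg_approx {K ε a b c d e e₀ q θ R η : ℝ} (hK : 16 ≤ K)
    (hsum : a ^ 2 + b ^ 2 + c ^ 2 + d ^ 2 + e ^ 2 = 1 + η) (hη : |η| ≤ ε)
    (hq0 : 0 ≤ q) (hq1 : q ≤ 1 / K ^ 100) (hR : |R| ≤ 40 / K ^ 90)
    (ha : |a| ≤ 2) (hd : |d| ≤ 2) (he : |e| ≤ 2) (he0 : 0 ≤ e₀) (he02 : e₀ ≤ 2)
    (hee₀ : e₀ - ε ≤ e) (hbc : b ^ 2 + c ^ 2 ≤ 9 * ε) (hθ : |θ| ≤ ε)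
    (hε : 0 < ε) (hε100 : ε ≤ 1 / K ^ 100) :
    (-(e * (K * d ^ 2 + θ)) - K / 2 * ((a ^ 2 - d ^ 2 + R) * e + a * d * q * (K * d ^ 2 + θ)))
      + K * e₀ * ((1 - e * e) / 2 - K / 2 * (a * d * q * e)) ≤ 80 / K ^ 89 := by
  have hK0 : 0 < K := by linarith
  have hK1 : 1 ≤ K := by linarith
  have hε1 : ε ≤ 1 := hε100.trans (by
    rw [div_le_one (by positivity)]; exact one_le_pow₀ hK1)
  have key : (-(e * (K * d ^ 2 + θ))
        - K / 2 * ((a ^ 2 - d ^ 2 + R) * e + a * d * q * (K * d ^ 2 + θ)))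
      + K * e₀ * ((1 - e * e) / 2 - K / 2 * (a * d * q * e))
      = K / 2 * (a ^ 2 + d ^ 2) * (e₀ - e) + K / 2 * e₀ * (b ^ 2 + c ^ 2) - K / 2 * e₀ * η
        - e * θ - K / 2 * R * e - K ^ 2 / 2 * (a * d * q) * d ^ 2 - K / 2 * (a * d * q) * θ
        - K ^ 2 / 2 * e₀ * (a * d * q) * e := by
    linear_combination (-(K / 2) * e₀) * hsum
  rw [key]
  have ha4 : a ^ 2 ≤ 2 ^ 2 := by rw [← sq_abs]; exact pow_le_pow_left₀ (abs_nonneg _) ha 2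
  have hd4 : d ^ 2 ≤ 2 ^ 2 := by rw [← sq_abs]; exact pow_le_pow_left₀ (abs_nonneg _) hd 2
  have hV : |a * d * q| ≤ 4 / K ^ 100 := by
    rw [abs_mul, abs_mul, abs_of_nonneg hq0]
    calc |a| * |d| * q ≤ 2 * 2 * (1 / K ^ 100) :=
          mul_le_mul (mul_le_mul ha hd (abs_nonneg _) (by norm_num)) hq1 hq0 (by norm_num)
      _ = 4 / K ^ 100 := by ring
  have t1 : K / 2 * (a ^ 2 + d ^ 2) * (e₀ - e) ≤ 4 * (K * ε) := by
    have h1 : 0 ≤ K / 2 * (a ^ 2 + d ^ 2) := by positivity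
    calc K / 2 * (a ^ 2 + d ^ 2) * (e₀ - e) ≤ K / 2 * (a ^ 2 + d ^ 2) * ε :=
          mul_le_mul_of_nonneg_left (by linarith) h1
      _ ≤ K / 2 * (2 ^ 2 + 2 ^ 2) * ε :=
          mul_le_mul_of_nonneg_right (mul_le_mul_of_nonneg_left (by linarith) (by positivity))
            hε.le
      _ = 4 * (K * ε) := by ring
  have t2 : K / 2 * e₀ * (b ^ 2 + c ^ 2) ≤ 9 * (K * ε) := by
    calc K / 2 * e₀ * (b ^ 2 + c ^ 2) ≤ K / 2 * 2 * (9 * ε) :=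
          mul_le_mul (mul_le_mul_of_nonneg_left he02 (by positivity)) hbc (by positivity)
            (by positivity)
      _ = 9 * (K * ε) := by ring
  have t3 : -(K / 2 * e₀ * η) ≤ K * ε := by
    have : |K / 2 * e₀ * η| ≤ K / 2 * 2 * ε := by
      rw [abs_mul, abs_mul, abs_of_pos (by positivity : 0 < K / 2), abs_of_nonneg he0]
      exact mul_le_mul (mul_le_mul_of_nonneg_left he02 (by positivity)) hη (abs_nonneg _)
        (by positivity)
    have h' := (abs_le.1 this).1
    linarith
  have t4 : -(e * θ) ≤ 2 * ε := by
    have : |e * θ| ≤ 2 * ε := by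
      rw [abs_mul]; exact mul_le_mul he hθ (abs_nonneg _) (by norm_num)
    linarith [(abs_le.1 this).1]
  have t5 : -(K / 2 * R * e) ≤ 40 / K ^ 89 := by
    have : |K / 2 * R * e| ≤ K / 2 * (40 / K ^ 90) * 2 := by
      rw [abs_mul, abs_mul, abs_of_pos (by positivity : 0 < K / 2)]
      exact mul_le_mul (mul_le_mul_of_nonneg_left hR (by positivity)) he (abs_nonneg _)
        (by positivity)
    have h' := (abs_le.1 this).1
    have e5 : K / 2 * (40 / K ^ 90) * 2 = 40 / K ^ 89 := by
      rw [show K / 2 * (40 / K ^ 90) * 2 = 40 * K / K ^ 90 by ring,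
        div_eq_div_iff (by positivity) (by positivity)]
      ring
    linarith
  have t6 : -(K ^ 2 / 2 * (a * d * q) * d ^ 2) ≤ 8 / K ^ 98 := by
    have : |K ^ 2 / 2 * (a * d * q) * d ^ 2| ≤ K ^ 2 / 2 * (4 / K ^ 100) * 2 ^ 2 := by
      rw [abs_mul, abs_mul, abs_of_pos (by positivity : 0 < K ^ 2 / 2),
        abs_of_nonneg (sq_nonneg d)]
      exact mul_le_mul (mul_le_mul_of_nonneg_left hV (by positivity)) hd4 (sq_nonneg _)
        (by positivity)
    have h' := (abs_le.1 this).1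
    have e6 : K ^ 2 / 2 * (4 / K ^ 100) * 2 ^ 2 = 8 / K ^ 98 := by
      rw [show K ^ 2 / 2 * (4 / K ^ 100) * 2 ^ 2 = 8 * K ^ 2 / K ^ 100 by ring,
        div_eq_div_iff (by positivity) (by positivity)]
      ring
    linarith
  have t7 : -(K / 2 * (a * d * q) * θ) ≤ 2 / K ^ 99 := by
    have : |K / 2 * (a * d * q) * θ| ≤ K / 2 * (4 / K ^ 100) * 1 := by
      rw [abs_mul, abs_mul, abs_of_pos (by positivity : 0 < K / 2)]
      exact mul_le_mul (mul_le_mul_of_nonneg_left hV (by positivity)) (hθ.trans hε1)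
        (abs_nonneg _) (by positivity)
    have h' := (abs_le.1 this).1
    have e7 : K / 2 * (4 / K ^ 100) * 1 = 2 / K ^ 99 := by
      rw [show K / 2 * (4 / K ^ 100) * 1 = 2 * K / K ^ 100 by ring,
        div_eq_div_iff (by positivity) (by positivity)]
      ring
    linarith
  have t8 : -(K ^ 2 / 2 * e₀ * (a * d * q) * e) ≤ 8 / K ^ 98 := by
    have : |K ^ 2 / 2 * e₀ * (a * d * q) * e| ≤ K ^ 2 / 2 * 2 * (4 / K ^ 100) * 2 := by
      rw [abs_mul, abs_mul, abs_mul, abs_of_pos (by positivity : 0 < K ^ 2 / 2),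
        abs_of_nonneg he0]
      exact mul_le_mul (mul_le_mul (mul_le_mul_of_nonneg_left he02 (by positivity)) hV
        (abs_nonneg _) (by positivity)) he (abs_nonneg _) (by positivity)
    have h' := (abs_le.1 this).1
    have e8 : K ^ 2 / 2 * 2 * (4 / K ^ 100) * 2 = 8 / K ^ 98 := by
      rw [show K ^ 2 / 2 * 2 * (4 / K ^ 100) * 2 = 8 * K ^ 2 / K ^ 100 by ring,
        div_eq_div_iff (by positivity) (by positivity)]
      ring
    linarith
  -- numerics: everything in units of `1/K^89`
  have hKε : K * ε ≤ 1 / K ^ 99 := by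
    calc K * ε ≤ K * (1 / K ^ 100) := mul_le_mul_of_nonneg_left hε100 hK0.le
      _ = 1 / K ^ 99 := by
          rw [mul_one_div, div_eq_div_iff (by positivity) (by positivity)]; ring
  have h99 : 1 / K ^ 99 ≤ 1 / K ^ 89 :=
    div_le_div_of_nonneg_left (by norm_num) (by positivity) (pow_le_pow_right₀ hK1 (by norm_num))
  have h98 : 1 / K ^ 98 ≤ 1 / K ^ 89 :=
    div_le_div_of_nonneg_left (by norm_num) (by positivity) (pow_le_pow_right₀ hK1 (by norm_num))
  have h100 : 1 / K ^ 100 ≤ 1 / K ^ 89 :=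
    div_le_div_of_nonneg_left (by norm_num) (by positivity) (pow_le_pow_right₀ hK1 (by norm_num))
  have r1 : (40 : ℝ) / K ^ 89 = 40 * (1 / K ^ 89) := by ring
  have r2 : (8 : ℝ) / K ^ 98 = 8 * (1 / K ^ 98) := by ring
  have r3 : (2 : ℝ) / K ^ 99 = 2 * (1 / K ^ 99) := by ring
  have r4 : (80 : ℝ) / K ^ 89 = 80 * (1 / K ^ 89) := by ring
  rw [r4]
  rw [r1] at t5
  rw [r2] at t6 t8
  rw [r3] at t7
  linarith

section Approx

variable {K M ε δ δ₀ T : ℝ} {Y V : ℝ → Fin 5 → ℝ}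
  (hY : ∀ t, HasDerivAt Y (V t) t)
  (hV : ∀ t ∈ Ico 0 T, ‖V t - delayCircuitWith K M ε (Y t)‖ ≤ δ)
  (hR : ∀ t ∈ Ico 0 T, ‖Y t‖ ≤ 2) (hT : 2 ≤ T)
include hY hV hR hT

omit hV hR hT in
/-- **The modified energy of an approximate trajectory.** `E_* = ½(1 - ã²) - ½K·V·ã`
(`V = adε²/c`) has `∂ₜE_* = -ã·ã' - ½K(∂ₜV·ã + V·ã')` wherever `c ≠ 0` (`ã' = V₄`, `∂ₜV` as in
`hasDerivAt_corrector`). [cite: Tao2016AveragedNS, §5.5 (proof of (beable))] -/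
theorem hasDerivAt_Es {t : ℝ} (hc : Y t 2 ≠ 0) :
    HasDerivAt (fun s => (1 - Y s 4 * Y s 4) / 2
        - K / 2 * (Y s 0 * Y s 3 * (ε ^ 2 * (Y s 2)⁻¹) * Y s 4))
      (-(Y t 4 * V t 4) - K / 2 *
        (((V t 0 * Y t 3 + Y t 0 * V t 3) * (ε ^ 2 * (Y t 2)⁻¹)
            - Y t 0 * Y t 3 * (ε ^ 2 * (Y t 2)⁻¹) * (V t 2 * (Y t 2)⁻¹)) * Y t 4
          + Y t 0 * Y t 3 * (ε ^ 2 * (Y t 2)⁻¹) * V t 4)) t := by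
  have h4 := hasDerivAt_coord (hY t) 4
  have hEE := ((h4.fun_mul h4).const_sub 1).div_const 2
  have hVE := ((hasDerivAt_corrector (ε := ε) hY hc).fun_mul h4).const_mul (K / 2)
  refine (hEE.fun_sub hVE).congr_deriv ?_
  ring

section Late

variable {T' : ℝ} (hT'T : T' < T) (hT'2 : T' ≤ 2)
include hT'T hT'2

section Eighth

/-! ### The same, under the WEAK budget `δ₀ + 2δ ≤ ε²e^{-M}/8` (primed names; the unprimed
names below re-export them under the seed-scale budget with unchanged statements) -/

variable (hK : 2 * 20 ^ 42 * (Nat.factorial 42 : ℝ) + 16 ≤ K) (hML : 3000 * Real.log K ≤ M)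
  (hMK : M ≤ K ^ 10) (hε : 0 < ε) (hεle : ε ≤ exp (-(10 * M)) / K ^ 100)
  (h0 : ‖Y 0 - delayInit‖ ≤ δ₀) (hη : δ₀ + 2 * δ ≤ ε ^ 2 * exp (-M) / 8)
include hK hML hMK hε hεle h0 hη

omit hY hR hT'T hT'2 in
/-- Numerics of the firing phase: `ε ≤ K⁻¹⁰⁰`, `δ ≤ ε`, `7δ₀ + 40δ ≤ ε`, `20 ≤ √K`,
`(√K)⁻¹ ≤ 1/20`, `K⁻¹ ≤ 1/32`, `K·(√K)⁻¹ = √K`, and the numeric input `2e^{(1-√K)/10} ≤ K⁻²⁰`.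
[cite: Tao2016AveragedNS, §5.5 ("for `K` sufficiently large")] -/
theorem firing_params' : ε ≤ 1 / K ^ 100 ∧ δ ≤ ε ∧ 7 * δ₀ + 40 * δ ≤ ε ∧
    20 ≤ Real.sqrt K ∧ (Real.sqrt K)⁻¹ ≤ 1 / 20 ∧ K⁻¹ ≤ 1 / 32 ∧
    K * (Real.sqrt K)⁻¹ = Real.sqrt K ∧ 2 * exp ((1 - Real.sqrt K) / 10) ≤ 1 / K ^ 20 := by
  obtain ⟨hM6000, hε1, -, -, -, -, -, -, -⟩ := ignition_params hK hML hMK hε hεle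
  obtain ⟨hK16, -, -, -, -, -⟩ := negKick_params hK hML hMK hε hεle
  obtain ⟨hsε, -, hδs, hA⟩ := late_facts' hV hT hK hML hMK hε hεle h0 hη
  obtain ⟨-, -, -, -, hN4, -, -, -, -⟩ := Thm53With.family_params hK hML
  obtain ⟨-, -, hKs, -, -⟩ := Thm53.invSqrt_facts hK16
  have hK0 : 0 < K := by linarith
  have hf1 : (1 : ℝ) ≤ (Nat.factorial 42 : ℝ) := by
    exact_mod_cast Nat.succ_le_of_lt (Nat.factorial_pos 42)
  have hf2 : (400 : ℝ) ≤ 2 * 20 ^ 42 * (Nat.factorial 42 : ℝ) :=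
    le_trans (by norm_num) (le_mul_of_one_le_right (by positivity) hf1)
  have hK400 : (20 : ℝ) ^ 2 ≤ K := by linarith
  have h20 : (20 : ℝ) ≤ Real.sqrt K := by
    rw [show (20 : ℝ) = Real.sqrt (20 ^ 2) by rw [Real.sqrt_sq (by norm_num)]]
    exact Real.sqrt_le_sqrt hK400
  have hs20 : (Real.sqrt K)⁻¹ ≤ 1 / 20 := by
    rw [inv_le_comm₀ (by positivity) (by norm_num)]; simpa using h20
  have hKinv : K⁻¹ ≤ 1 / 32 := by rw [inv_le_comm₀ hK0 (by norm_num)]; linarith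
  have hε100 : ε ≤ 1 / K ^ 100 :=
    hεle.trans (div_le_div_of_nonneg_right (exp_le_one_iff.2 (by linarith)) (by positivity))
  have hs0 : 0 ≤ ε ^ 2 * exp (-M) := by positivity
  exact ⟨hε100, by linarith, by linarith, h20, hs20, hKinv, hKs, hN4⟩

section Entry

variable {τ : ℝ} (hτ1 : 1 < τ) (hcτ : Y τ 2 = ε ^ 2 / K ^ 10) (hbτ : 49 / 50 * ε ≤ Y τ 1)
include hτ1 hcτ hbτ

section Onset

variable {d : ℝ} (hd : 0 ≤ d) (hon : 2 * K ^ 110 ≤ exp (9 / 10 * M * d))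
include hd hon

/-! ## §2. (toke): the modified energy decays -/

/-- `|V| = |adε²/c| ≤ 4K⁻¹⁰⁰` on `[τ + d, T']`. [cite: Tao2016AveragedNS, §5.5 (c-large)] -/
theorem abs_corrector_le' {t : ℝ} (ht : t ∈ Icc (τ + d) T') :
    |Y t 0 * Y t 3 * (ε ^ 2 * (Y t 2)⁻¹)| ≤ 4 / K ^ 100 := by
  obtain ⟨hK16, -, -, -, -, -⟩ := negKick_params hK hML hMK hε hεle
  have hK0 : 0 < K := by linarith
  have ht0 : t ∈ Icc (0 : ℝ) T' := ⟨by linarith [ht.1], ht.2⟩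
  have hcl := c_large_after' hY hV hR hT hT'T hT'2 hK hML hMK hε hεle h0 hη hτ1 hcτ hbτ hd hon ht
  have hcpos : 0 < Y t 2 := lt_of_lt_of_le (by positivity) hcl
  have hq0 : 0 ≤ ε ^ 2 * (Y t 2)⁻¹ := by positivity
  have hq : ε ^ 2 * (Y t 2)⁻¹ ≤ 1 / K ^ 100 := by
    rw [← div_eq_mul_inv, div_le_div_iff₀ hcpos (by positivity), one_mul]; linarith
  rw [abs_mul, abs_mul, abs_of_nonneg hq0]
  calc |Y t 0| * |Y t 3| * (ε ^ 2 * (Y t 2)⁻¹) ≤ 2 * 2 * (1 / K ^ 100) :=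
        mul_le_mul (mul_le_mul (abs_coord_le_two hR hT'T ht0 0) (abs_coord_le_two hR hT'T ht0 3)
          (abs_nonneg _) (by norm_num)) hq hq0 (by norm_num)
    _ = 4 / K ^ 100 := by ring

/-- `|½K·V·ã| ≤ 4K⁻⁹⁹` on `[τ + d, T']`. [cite: Tao2016AveragedNS, §5.5 (proof of (beable))] -/
theorem abs_KVe_le' {t : ℝ} (ht : t ∈ Icc (τ + d) T') :
    |K / 2 * (Y t 0 * Y t 3 * (ε ^ 2 * (Y t 2)⁻¹) * Y t 4)| ≤ 4 / K ^ 99 := by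
  obtain ⟨hK16, -, -, -, -, -⟩ := negKick_params hK hML hMK hε hεle
  have hK0 : 0 < K := by linarith
  have ht0 : t ∈ Icc (0 : ℝ) T' := ⟨by linarith [ht.1], ht.2⟩
  have hVt := abs_corrector_le' hY hV hR hT hT'T hT'2 hK hML hMK hε hεle h0 hη hτ1 hcτ hbτ hd hon ht
  have he := abs_coord_le_two hR hT'T ht0 4
  rw [abs_mul, abs_of_pos (by positivity : 0 < K / 2), abs_mul]
  calc K / 2 * (|Y t 0 * Y t 3 * (ε ^ 2 * (Y t 2)⁻¹)| * |Y t 4|) ≤ K / 2 * (4 / K ^ 100 * 2) :=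
        mul_le_mul_of_nonneg_left (mul_le_mul hVt he (abs_nonneg _) (by positivity))
          (by positivity)
    _ = 4 / K ^ 99 := by
        rw [show K / 2 * (4 / K ^ 100 * 2) = 4 * K / K ^ 100 by ring,
          div_eq_div_iff (by positivity) (by positivity)]
        ring

/-- **Dissipation of `E_*` for approximate trajectories**: on `[t', T']`, `t' = τ + d + 1/K`,
`∂ₜE_* + Kã(t')E_* ≤ 80K⁻⁸⁹`. [cite: Tao2016AveragedNS, §5.5 (proof of (beable))] -/
theorem Es_dissipation_after' (hfit : τ + d + K⁻¹ ≤ T') {s : ℝ}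
    (hs : s ∈ Icc (τ + d + K⁻¹) T') :
    (-(Y s 4 * V s 4) - K / 2 *
        (((V s 0 * Y s 3 + Y s 0 * V s 3) * (ε ^ 2 * (Y s 2)⁻¹)
            - Y s 0 * Y s 3 * (ε ^ 2 * (Y s 2)⁻¹) * (V s 2 * (Y s 2)⁻¹)) * Y s 4
          + Y s 0 * Y s 3 * (ε ^ 2 * (Y s 2)⁻¹) * V s 4))
      + K * Y (τ + d + K⁻¹) 4 * ((1 - Y s 4 * Y s 4) / 2
          - K / 2 * (Y s 0 * Y s 3 * (ε ^ 2 * (Y s 2)⁻¹) * Y s 4)) ≤ 80 / K ^ 89 := by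
  obtain ⟨hK16, -, -, -, -, -⟩ := negKick_params hK hML hMK hε hεle
  obtain ⟨hδ₀, hδ, -, hδ₀1, -, -⟩ := budget_facts' hV hT hK hML hMK hε hεle h0 hη
  obtain ⟨hε100, hδε, hAε, -, -, -, -, -⟩ :=
    firing_params' hV hT hK hML hMK hε hεle h0 hη
  have hK0 : 0 < K := by linarith
  have hτ0 : (0 : ℝ) ≤ τ := by linarith
  have hKi0 : 0 < K⁻¹ := inv_pos.2 hK0
  have hsO : s ∈ Icc (τ + d) T' := ⟨by linarith [hs.1], hs.2⟩
  have hs0 : s ∈ Icc (0 : ℝ) T' := ⟨by linarith [hs.1], hs.2⟩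
  have ht'0 : τ + d + K⁻¹ ∈ Icc (0 : ℝ) T' := ⟨by linarith, hfit⟩
  have hcl := c_large_after' hY hV hR hT hT'T hT'2 hK hML hMK hε hεle h0 hη hτ1 hcτ hbτ hd hon hsO
  have hcpos : 0 < Y s 2 := lt_of_lt_of_le (by positivity) hcl
  have hq0 : 0 ≤ ε ^ 2 * (Y s 2)⁻¹ := by positivity
  have hq1 : ε ^ 2 * (Y s 2)⁻¹ ≤ 1 / K ^ 100 := by
    rw [← div_eq_mul_inv, div_le_div_iff₀ hcpos (by positivity), one_mul]; linarith
  have hRm := corrector_remainder_le' hY hV hR hT hT'T hT'2 hK hML hMK hε hεle h0 hη hτ1 hcτ hbτ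
    hd hon hsO
  have hθ' := abs_coord_defect_le (hV s (mem_Ico_of_mem_late hT'T hs0)) 4
  rw [field_four] at hθ'
  have hθ : |V s 4 - K * Y s 3 ^ 2| ≤ ε := hθ'.trans hδε
  have hEn := abs_energy_sub_one_late hY hV hR hT hT'T hT'2 h0 hδ₀1 hs0
  have hηε : |energy (Y s) - 1| ≤ ε := hEn.trans hAε
  have hsum : Y s 0 ^ 2 + Y s 1 ^ 2 + Y s 2 ^ 2 + Y s 3 ^ 2 + Y s 4 ^ 2 =
      1 + (energy (Y s) - 1) := by
    rw [energy_five]; ring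
  have ha := abs_coord_le_two hR hT'T hs0 0
  have hd' := abs_coord_le_two hR hT'T hs0 3
  have he := abs_coord_le_two hR hT'T hs0 4
  have he₀ := e_tenth_after' hY hV hR hT hT'T hT'2 hK hML hMK hε hεle h0 hη hτ1 hcτ hbτ hd hon hfit
  have he02 : Y (τ + d + K⁻¹) 4 ≤ 2 := (le_abs_self _).trans (abs_coord_le_two hR hT'T ht'0 4)
  have hee : Y (τ + d + K⁻¹) 4 - ε ≤ Y s 4 := by
    have h := e_sub_ge_late hY hV hT'T hK0.le ht'0.1 hs.1 hs.2
    have : δ * (s - (τ + d + K⁻¹)) ≤ δ * 1 :=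
      mul_le_mul_of_nonneg_left (by linarith [hs.2]) hδ
    linarith
  have hbc := bc_sq_late' hY hV hR hT hT'T hT'2 hK hML hMK hε hεle h0 hη hs0
  have halg := Es_alg_approx hK16 hsum hηε hq0 hq1 hRm ha hd' he (by linarith) he02 hee hbc hθ
    hε hε100
  linarith

/-- **(toke) for approximate trajectories**: on `[t', T']`, `t' = τ + d + 1/K`,
`E_*(t) ≤ e^{(K/10)(t' - t)} + 800K⁻⁹⁰` (Grönwall from `t'`, `ã(t') ≥ 1/10`, `E_*(t') ≤ 1`).
[cite: Tao2016AveragedNS, §5.5 (toke)] -/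
theorem Es_decay_after' (hfit : τ + d + K⁻¹ ≤ T') {t : ℝ} (ht : t ∈ Icc (τ + d + K⁻¹) T') :
    (1 - Y t 4 * Y t 4) / 2 - K / 2 * (Y t 0 * Y t 3 * (ε ^ 2 * (Y t 2)⁻¹) * Y t 4)
      ≤ exp (K / 10 * ((τ + d + K⁻¹) - t)) + 800 / K ^ 90 := by
  obtain ⟨hK16, -, -, -, -, -⟩ := negKick_params hK hML hMK hε hεle
  have hK0 : 0 < K := by linarith
  have hK1 : 1 ≤ K := by linarith
  have hτ0 : (0 : ℝ) ≤ τ := by linarith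
  have hKi0 : 0 < K⁻¹ := inv_pos.2 hK0
  have he₀ : 1 / 10 ≤ Y (τ + d + K⁻¹) 4 :=
    e_tenth_after' hY hV hR hT hT'T hT'2 hK hML hMK hε hεle h0 hη hτ1 hcτ hbτ hd hon hfit
  have he₀pos : 0 < Y (τ + d + K⁻¹) 4 := lt_of_lt_of_le (by norm_num) he₀
  have hKe : 0 < K * Y (τ + d + K⁻¹) 4 := mul_pos hK0 he₀pos
  have hI : ∀ s ∈ Icc (τ + d + K⁻¹) T', s ∈ Icc (τ + d) T' := fun s hs =>
    ⟨by linarith [hs.1], hs.2⟩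
  have hC0 : 0 ≤ 80 / K ^ 89 / (K * Y (τ + d + K⁻¹) 4) := by positivity
  -- Grönwall in integrating-factor form
  have hanti := Thm53.antitoneOn_intFactor (s := Icc (τ + d + K⁻¹) T')
    (f := fun s => (1 - Y s 4 * Y s 4) / 2 - K / 2 * (Y s 0 * Y s 3 * (ε ^ 2 * (Y s 2)⁻¹) * Y s 4))
    (g := fun _ => -(K * Y (τ + d + K⁻¹) 4)) (G := fun s => -(K * Y (τ + d + K⁻¹) 4 * s))
    (φ := fun s => 80 / K ^ 89 * exp (K * Y (τ + d + K⁻¹) 4 * s))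
    (Φ := fun s => 80 / K ^ 89 / (K * Y (τ + d + K⁻¹) 4) * exp (K * Y (τ + d + K⁻¹) 4 * s))
    (convex_Icc _ _)
    (fun s hs => by
      have hcl : K ^ 100 * ε ^ 2 ≤ Y s 2 := c_large_after' hY hV hR hT hT'T hT'2 hK hML hMK hε hεle
        h0 hη hτ1 hcτ hbτ hd hon (hI s hs)
      have hcne : Y s 2 ≠ 0 := (lt_of_lt_of_le (by positivity) hcl).ne'
      exact hasDerivAt_Es hY hcne)
    (fun s _ => ((hasDerivAt_id s).const_mul (K * Y (τ + d + K⁻¹) 4)).neg.congr_deriv (by simp))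
    (fun s _ => by
      have hne : K * Y (τ + d + K⁻¹) 4 ≠ 0 := hKe.ne'
      have := (((hasDerivAt_id s).const_mul (K * Y (τ + d + K⁻¹) 4)).exp).const_mul
        (80 / K ^ 89 / (K * Y (τ + d + K⁻¹) 4))
      refine this.congr_deriv ?_
      simp only [mul_one, id_eq]
      generalize Y (τ + d + K⁻¹) 4 = e₀ at hne ⊢
      have hne' : e₀ ≠ 0 := right_ne_zero_of_mul hne
      field_simp)
    (fun s hs => by
      have hdis := Es_dissipation_after' hY hV hR hT hT'T hT'2 hK hML hMK hε hεle h0 hη hτ1 hcτ hbτ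
        hd hon hfit hs
      have hE : exp (-(-(K * Y (τ + d + K⁻¹) 4 * s))) = exp (K * Y (τ + d + K⁻¹) 4 * s) := by
        rw [neg_neg]
      rw [hE]
      have h2 := mul_le_mul_of_nonneg_right hdis (exp_pos (K * Y (τ + d + K⁻¹) 4 * s)).le
      linarith)
  have ht'mem : τ + d + K⁻¹ ∈ Icc (τ + d + K⁻¹) T' := ⟨le_rfl, hfit⟩
  have hA := hanti ht'mem ht ht.1
  simp only [neg_neg] at hA
  have hsplit : exp (K * Y (τ + d + K⁻¹) 4 * (τ + d + K⁻¹))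
      = exp (K * Y (τ + d + K⁻¹) 4 * t) *
        exp (K * Y (τ + d + K⁻¹) 4 * ((τ + d + K⁻¹) - t)) := by
    rw [← exp_add]; congr 1; ring
  rw [hsplit] at hA
  -- `E_*(t') ≤ 1`
  have hEs1 : (1 - Y (τ + d + K⁻¹) 4 * Y (τ + d + K⁻¹) 4) / 2
      - K / 2 * (Y (τ + d + K⁻¹) 0 * Y (τ + d + K⁻¹) 3 * (ε ^ 2 * (Y (τ + d + K⁻¹) 2)⁻¹)
        * Y (τ + d + K⁻¹) 4) ≤ 1 := by
    have h1 : (1 - Y (τ + d + K⁻¹) 4 * Y (τ + d + K⁻¹) 4) / 2 ≤ 1 / 2 := by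
      linarith [mul_self_nonneg (Y (τ + d + K⁻¹) 4)]
    have h2 := (abs_le.1 (abs_KVe_le' hY hV hR hT hT'T hT'2 hK hML hMK hε hεle h0 hη hτ1 hcτ hbτ
      hd hon (hI _ ht'mem))).1
    have h3 : 4 / K ^ 99 ≤ 1 / 2 := by
      rw [div_le_div_iff₀ (by positivity) (by norm_num)]
      have : (16 : ℝ) ≤ K ^ 99 := le_trans hK16 (le_self_pow₀ hK1 (by norm_num))
      linarith
    linarith
  have hρ0 : 0 < exp (K * Y (τ + d + K⁻¹) 4 * ((τ + d + K⁻¹) - t)) := exp_pos _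
  have hEst := Thm53.decay_alg (exp_pos _) hρ0 hC0 hEs1 hA
  -- `ρ ≤ exp((K/10)(t' - t))`
  have hρle : exp (K * Y (τ + d + K⁻¹) 4 * ((τ + d + K⁻¹) - t)) ≤
      exp (K / 10 * ((τ + d + K⁻¹) - t)) := by
    rw [exp_le_exp]
    have hn : (τ + d + K⁻¹) - t ≤ 0 := by linarith [ht.1]
    have := mul_le_mul_of_nonpos_right (mul_le_mul_of_nonneg_left he₀ hK0.le) hn
    have e1 : K * (1 / 10) * ((τ + d + K⁻¹) - t) = K / 10 * ((τ + d + K⁻¹) - t) := by ring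
    linarith
  have hCle : 80 / K ^ 89 / (K * Y (τ + d + K⁻¹) 4) ≤ 800 / K ^ 90 := by
    rw [div_le_div_iff₀ hKe (by positivity)]
    have e1 : 80 / K ^ 89 * K ^ 90 = 80 * K := by
      rw [div_mul_eq_mul_div, div_eq_iff (by positivity)]; ring
    rw [e1]
    have := mul_le_mul_of_nonneg_left he₀ hK0.le
    linarith
  linarith

/-! ## §3. (able): equipartition has eaten the carrier and the rotor -/

/-- **(toke) ⇒ a² + d² small**: on `[t' + 1/√K, T']`, `a² + d² ≤ 2K⁻²⁰`
(`a² + d² = η + 2E_* + KVã - b² - c²`, `2e^{-√K/10} ≤ K⁻²⁰`).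
[cite: Tao2016AveragedNS, §5.5 (beable)] -/
theorem ad_sq_le_after' (hfit : τ + d + K⁻¹ ≤ T') {t : ℝ}
    (ht : t ∈ Icc (τ + d + K⁻¹ + (Real.sqrt K)⁻¹) T') :
    Y t 0 ^ 2 + Y t 3 ^ 2 ≤ 2 / K ^ 20 := by
  obtain ⟨hK16, -, -, -, -, -⟩ := negKick_params hK hML hMK hε hεle
  obtain ⟨hδ₀, hδ, -, hδ₀1, -, -⟩ := budget_facts' hV hT hK hML hMK hε hεle h0 hη
  obtain ⟨hε100, hδε, hAε, h20, hs20, -, hKs, hN4⟩ :=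
    firing_params' hV hT hK hML hMK hε hεle h0 hη
  obtain ⟨hsq0, -, -, -, -⟩ := Thm53.invSqrt_facts hK16
  have hK0 : 0 < K := by linarith
  have hK1 : 1 ≤ K := by linarith
  have hτ0 : (0 : ℝ) ≤ τ := by linarith
  have hKi0 : 0 < K⁻¹ := inv_pos.2 hK0
  have htI : t ∈ Icc (τ + d + K⁻¹) T' := ⟨by linarith [ht.1, hsq0.le], ht.2⟩
  have htO : t ∈ Icc (τ + d) T' := ⟨by linarith [htI.1], ht.2⟩
  have ht0 : t ∈ Icc (0 : ℝ) T' := ⟨by linarith [htO.1], ht.2⟩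
  have hEs := Es_decay_after' hY hV hR hT hT'T hT'2 hK hML hMK hε hεle h0 hη hτ1 hcτ hbτ hd hon
    hfit htI
  have hKV := (abs_le.1 (abs_KVe_le' hY hV hR hT hT'T hT'2 hK hML hMK hε hεle h0 hη hτ1 hcτ hbτ
    hd hon htO)).2
  have hEn := (abs_le.1 ((abs_energy_sub_one_late hY hV hR hT hT'T hT'2 h0 hδ₀1 ht0).trans hAε)).2
  rw [energy_five] at hEn
  have hbc0 : 0 ≤ Y t 1 ^ 2 + Y t 2 ^ 2 := by positivity
  have hρ : exp (K / 10 * ((τ + d + K⁻¹) - t)) ≤ exp ((1 - Real.sqrt K) / 10) := by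
    rw [exp_le_exp]
    have h1 : (τ + d + K⁻¹) - t ≤ -(Real.sqrt K)⁻¹ := by linarith [ht.1]
    have h2 : K / 10 * ((τ + d + K⁻¹) - t) ≤ K / 10 * (-(Real.sqrt K)⁻¹) :=
      mul_le_mul_of_nonneg_left h1 (by positivity)
    have h3 : K / 10 * (-(Real.sqrt K)⁻¹) = -(K * (Real.sqrt K)⁻¹) / 10 := by ring
    rw [h3, hKs] at h2
    have h4 : -Real.sqrt K / 10 ≤ (1 - Real.sqrt K) / 10 := by linarith
    exact h2.trans h4
  -- numerics in the atom `w = 1/K^20`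
  have h90 : (1 : ℝ) / K ^ 90 = 1 / K ^ 70 * (1 / K ^ 20) := by
    rw [one_div_mul_one_div, ← pow_add]
  have h70 : (1 : ℝ) / K ^ 70 ≤ 1 / 10000 := by
    have := one_div_le_one_div_of_le (by norm_num) (pow_le_pow_left₀ (by norm_num) hK16 70)
    exact this.trans (by norm_num)
  have hP : (1 : ℝ) / K ^ 90 ≤ 1 / 10000 * (1 / K ^ 20) := by
    rw [h90]; exact mul_le_mul_of_nonneg_right h70 (by positivity)
  have h99 : (1 : ℝ) / K ^ 99 ≤ 1 / K ^ 90 :=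
    div_le_div_of_nonneg_left (by norm_num) (by positivity) (pow_le_pow_right₀ hK1 (by norm_num))
  have h100 : (1 : ℝ) / K ^ 100 ≤ 1 / K ^ 90 :=
    div_le_div_of_nonneg_left (by norm_num) (by positivity) (pow_le_pow_right₀ hK1 (by norm_num))
  have r1 : (800 : ℝ) / K ^ 90 = 800 * (1 / K ^ 90) := by ring
  have r2 : (4 : ℝ) / K ^ 99 = 4 * (1 / K ^ 99) := by ring
  have r3 : (2 : ℝ) / K ^ 20 = 2 * (1 / K ^ 20) := by ring
  rw [r1] at hEs
  rw [r2] at hKV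
  rw [r3]
  have hee : Y t 4 * Y t 4 = Y t 4 ^ 2 := by ring
  linarith

/-- **(able) for approximate trajectories**: on `[t' + 1/√K, T']` (`t' = τ + d + 1/K`),
`|ã - 1| ≤ 4K⁻²⁰` and `|a|, |b|, |c|, |d| ≤ 2K⁻¹⁰`. [cite: Tao2016AveragedNS, §5.5 (able)] -/
theorem fired_after' (hfit : τ + d + K⁻¹ ≤ T') {t : ℝ}
    (ht : t ∈ Icc (τ + d + K⁻¹ + (Real.sqrt K)⁻¹) T') :
    |Y t 4 - 1| ≤ 4 / K ^ 20 ∧ ∀ i : Fin 5, i ≠ 4 → |Y t i| ≤ 2 / K ^ 10 := by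
  obtain ⟨hK16, -, -, -, -, -⟩ := negKick_params hK hML hMK hε hεle
  obtain ⟨hδ₀, hδ, -, hδ₀1, -, -⟩ := budget_facts' hV hT hK hML hMK hε hεle h0 hη
  obtain ⟨hε100, hδε, hAε, -, -, -, -, -⟩ :=
    firing_params' hV hT hK hML hMK hε hεle h0 hη
  obtain ⟨hsq0, -, -, -, -⟩ := Thm53.invSqrt_facts hK16
  have hK0 : 0 < K := by linarith
  have hK1 : 1 ≤ K := by linarith
  have hτ0 : (0 : ℝ) ≤ τ := by linarith
  have hKi0 : 0 < K⁻¹ := inv_pos.2 hK0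
  have htI : t ∈ Icc (τ + d + K⁻¹) T' := ⟨by linarith [ht.1, hsq0.le], ht.2⟩
  have ht0 : t ∈ Icc (0 : ℝ) T' := ⟨by linarith [htI.1], ht.2⟩
  have ht'0 : τ + d + K⁻¹ ∈ Icc (0 : ℝ) T' := ⟨by linarith, hfit⟩
  have had := ad_sq_le_after' hY hV hR hT hT'T hT'2 hK hML hMK hε hεle h0 hη hτ1 hcτ hbτ hd hon
    hfit ht
  have hbc := bc_sq_late' hY hV hR hT hT'T hT'2 hK hML hMK hε hεle h0 hη ht0
  have hEn := abs_le.1 ((abs_energy_sub_one_late hY hV hR hT hT'T hT'2 h0 hδ₀1 ht0).trans hAε)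
  rw [energy_five] at hEn
  obtain ⟨hEn1, hEn2⟩ := hEn
  -- numerics in the atom `w = 1/K^20`: `9ε ≤ w ≤ 1/16`
  have h9 : 9 * (1 / K ^ 100) ≤ 1 / K ^ 20 := by
    rw [mul_one_div, div_le_div_iff₀ (by positivity) (by positivity)]
    have h80 : (9 : ℝ) ≤ K ^ 80 := le_trans (by norm_num) (pow_le_pow_left₀ (by norm_num) hK16 80)
    calc (9 : ℝ) * K ^ 20 ≤ K ^ 80 * K ^ 20 := mul_le_mul_of_nonneg_right h80 (by positivity)
      _ = 1 * K ^ 100 := by ring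
  have hε9 : 9 * ε ≤ 1 / K ^ 20 := by linarith
  have hw16 : 1 / K ^ 20 ≤ 1 / 16 := by
    have h1 : 1 / K ^ 20 ≤ 1 / K :=
      one_div_le_one_div_of_le hK0 (le_self_pow₀ hK1 (by norm_num))
    have h2 : 1 / K ≤ 1 / 16 := one_div_le_one_div_of_le (by norm_num) hK16
    exact h1.trans h2
  have hw0 : (0 : ℝ) < 1 / K ^ 20 := by positivity
  have r2 : (2 : ℝ) / K ^ 20 = 2 * (1 / K ^ 20) := by ring
  have r4 : (4 : ℝ) / K ^ 20 = 4 * (1 / K ^ 20) := by ring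
  rw [r2] at had
  -- the output is positive: `ã ≥ ã(t') - δ ≥ 1/10 - δ`
  have he₀ := e_tenth_after' hY hV hR hT hT'T hT'2 hK hML hMK hε hεle h0 hη hτ1 hcτ hbτ hd hon hfit
  have hepos : 0 < Y t 4 := by
    have h := e_sub_ge_late hY hV hT'T hK0.le ht'0.1 htI.1 ht.2
    have : δ * (t - (τ + d + K⁻¹)) ≤ δ * 1 := mul_le_mul_of_nonneg_left (by linarith [ht.2]) hδ
    linarith
  have hs0 := sq_nonneg (Y t 0)
  have hs1 := sq_nonneg (Y t 1)
  have hs2 := sq_nonneg (Y t 2)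
  have hs3 := sq_nonneg (Y t 3)
  refine ⟨?_, ?_⟩
  · rw [r4, abs_sub_le_iff]
    constructor
    · rcases le_or_gt (Y t 4) 1 with h1 | h1
      · linarith
      · have hm : (Y t 4 - 1) * 1 ≤ (Y t 4 - 1) * (Y t 4 + 1) :=
          mul_le_mul_of_nonneg_left (by linarith) (by linarith)
        have hid : (Y t 4 - 1) * (Y t 4 + 1) = Y t 4 ^ 2 - 1 := by ring
        linarith
    · rcases le_or_gt 1 (Y t 4) with h1 | h1
      · linarith
      · have hm : (1 - Y t 4) * 1 ≤ (1 - Y t 4) * (1 + Y t 4) :=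
          mul_le_mul_of_nonneg_left (by linarith) (by linarith)
        have hid : (1 - Y t 4) * (1 + Y t 4) = 1 - Y t 4 ^ 2 := by ring
        linarith
  · have hsq : ∀ x : ℝ, x ^ 2 ≤ 4 * (1 / K ^ 20) → |x| ≤ 2 / K ^ 10 := by
      intro x hx
      have hx' : x ^ 2 ≤ (2 / K ^ 10) ^ 2 := by
        rw [div_pow, show (K ^ 10) ^ 2 = K ^ 20 by ring]
        have : (4 : ℝ) * (1 / K ^ 20) = 2 ^ 2 / K ^ 20 := by ring
        linarith
      calc |x| ≤ Real.sqrt ((2 / K ^ 10) ^ 2) := Real.abs_le_sqrt hx'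
        _ = 2 / K ^ 10 := Real.sqrt_sq (by positivity)
    have hx0 : Y t 0 ^ 2 ≤ 4 * (1 / K ^ 20) := by linarith
    have hx3 : Y t 3 ^ 2 ≤ 4 * (1 / K ^ 20) := by linarith
    have hx1 : Y t 1 ^ 2 ≤ 4 * (1 / K ^ 20) := by linarith
    have hx2 : Y t 2 ^ 2 ≤ 4 * (1 / K ^ 20) := by linarith
    intro i hi
    fin_cases i
    · exact hsq _ hx0
    · exact hsq _ hx1
    · exact hsq _ hx2
    · exact hsq _ hx3
    · exact (hi (by decide)).elim

end Onset

end Entry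

end Eighth

section Seed

variable (hK : 2 * 20 ^ 42 * (Nat.factorial 42 : ℝ) + 16 ≤ K) (hML : 3000 * Real.log K ≤ M)
  (hMK : M ≤ K ^ 10) (hε : 0 < ε) (hεle : ε ≤ exp (-(10 * M)) / K ^ 100)
  (h0 : ‖Y 0 - delayInit‖ ≤ δ₀) (hη : δ₀ + 2 * δ ≤ ε ^ 2 * exp (-M) / (8 * Real.sqrt M))
include hK hML hMK hε hεle h0 hη

omit hY hR hT'T hT'2 in
/-- Numerics of the firing phase: `ε ≤ K⁻¹⁰⁰`, `δ ≤ ε`, `7δ₀ + 40δ ≤ ε`, `20 ≤ √K`,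
`(√K)⁻¹ ≤ 1/20`, `K⁻¹ ≤ 1/32`, `K·(√K)⁻¹ = √K`, and the numeric input `2e^{(1-√K)/10} ≤ K⁻²⁰`.
[cite: Tao2016AveragedNS, §5.5 ("for `K` sufficiently large")] -/
theorem firing_params : ε ≤ 1 / K ^ 100 ∧ δ ≤ ε ∧ 7 * δ₀ + 40 * δ ≤ ε ∧
    20 ≤ Real.sqrt K ∧ (Real.sqrt K)⁻¹ ≤ 1 / 20 ∧ K⁻¹ ≤ 1 / 32 ∧
    K * (Real.sqrt K)⁻¹ = Real.sqrt K ∧ 2 * exp ((1 - Real.sqrt K) / 10) ≤ 1 / K ^ 20 :=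
  firing_params' hV hT hK hML hMK hε hεle h0 (budget_le_eighth hK hML hMK hε hεle hη)

section Entry

variable {τ : ℝ} (hτ1 : 1 < τ) (hcτ : Y τ 2 = ε ^ 2 / K ^ 10) (hbτ : 49 / 50 * ε ≤ Y τ 1)
include hτ1 hcτ hbτ

section Onset

variable {d : ℝ} (hd : 0 ≤ d) (hon : 2 * K ^ 110 ≤ exp (9 / 10 * M * d))
include hd hon

/-! ## §2. (toke): the modified energy decays -/

/-- `|V| = |adε²/c| ≤ 4K⁻¹⁰⁰` on `[τ + d, T']`. [cite: Tao2016AveragedNS, §5.5 (c-large)] -/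
theorem abs_corrector_le {t : ℝ} (ht : t ∈ Icc (τ + d) T') :
    |Y t 0 * Y t 3 * (ε ^ 2 * (Y t 2)⁻¹)| ≤ 4 / K ^ 100 :=
  abs_corrector_le' hY hV hR hT hT'T hT'2 hK hML hMK hε hεle h0
    (budget_le_eighth hK hML hMK hε hεle hη) hτ1 hcτ hbτ hd hon ht

/-- `|½K·V·ã| ≤ 4K⁻⁹⁹` on `[τ + d, T']`. [cite: Tao2016AveragedNS, §5.5 (proof of (beable))] -/
theorem abs_KVe_le {t : ℝ} (ht : t ∈ Icc (τ + d) T') :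
    |K / 2 * (Y t 0 * Y t 3 * (ε ^ 2 * (Y t 2)⁻¹) * Y t 4)| ≤ 4 / K ^ 99 :=
  abs_KVe_le' hY hV hR hT hT'T hT'2 hK hML hMK hε hεle h0
    (budget_le_eighth hK hML hMK hε hεle hη) hτ1 hcτ hbτ hd hon ht

/-- **Dissipation of `E_*` for approximate trajectories**: on `[t', T']`, `t' = τ + d + 1/K`,
`∂ₜE_* + Kã(t')E_* ≤ 80K⁻⁸⁹`. [cite: Tao2016AveragedNS, §5.5 (proof of (beable))] -/
theorem Es_dissipation_after (hfit : τ + d + K⁻¹ ≤ T') {s : ℝ}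
    (hs : s ∈ Icc (τ + d + K⁻¹) T') :
    (-(Y s 4 * V s 4) - K / 2 *
        (((V s 0 * Y s 3 + Y s 0 * V s 3) * (ε ^ 2 * (Y s 2)⁻¹)
            - Y s 0 * Y s 3 * (ε ^ 2 * (Y s 2)⁻¹) * (V s 2 * (Y s 2)⁻¹)) * Y s 4
          + Y s 0 * Y s 3 * (ε ^ 2 * (Y s 2)⁻¹) * V s 4))
      + K * Y (τ + d + K⁻¹) 4 * ((1 - Y s 4 * Y s 4) / 2
          - K / 2 * (Y s 0 * Y s 3 * (ε ^ 2 * (Y s 2)⁻¹) * Y s 4)) ≤ 80 / K ^ 89 :=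
  Es_dissipation_after' hY hV hR hT hT'T hT'2 hK hML hMK hε hεle h0
    (budget_le_eighth hK hML hMK hε hεle hη) hτ1 hcτ hbτ hd hon hfit hs

/-- **(toke) for approximate trajectories**: on `[t', T']`, `t' = τ + d + 1/K`,
`E_*(t) ≤ e^{(K/10)(t' - t)} + 800K⁻⁹⁰` (Grönwall from `t'`, `ã(t') ≥ 1/10`, `E_*(t') ≤ 1`).
[cite: Tao2016AveragedNS, §5.5 (toke)] -/
theorem Es_decay_after (hfit : τ + d + K⁻¹ ≤ T') {t : ℝ} (ht : t ∈ Icc (τ + d + K⁻¹) T') :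
    (1 - Y t 4 * Y t 4) / 2 - K / 2 * (Y t 0 * Y t 3 * (ε ^ 2 * (Y t 2)⁻¹) * Y t 4)
      ≤ exp (K / 10 * ((τ + d + K⁻¹) - t)) + 800 / K ^ 90 :=
  Es_decay_after' hY hV hR hT hT'T hT'2 hK hML hMK hε hεle h0
    (budget_le_eighth hK hML hMK hε hεle hη) hτ1 hcτ hbτ hd hon hfit ht

/-! ## §3. (able): equipartition has eaten the carrier and the rotor -/

/-- **(toke) ⇒ a² + d² small**: on `[t' + 1/√K, T']`, `a² + d² ≤ 2K⁻²⁰`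
(`a² + d² = η + 2E_* + KVã - b² - c²`, `2e^{-√K/10} ≤ K⁻²⁰`).
[cite: Tao2016AveragedNS, §5.5 (beable)] -/
theorem ad_sq_le_after (hfit : τ + d + K⁻¹ ≤ T') {t : ℝ}
    (ht : t ∈ Icc (τ + d + K⁻¹ + (Real.sqrt K)⁻¹) T') :
    Y t 0 ^ 2 + Y t 3 ^ 2 ≤ 2 / K ^ 20 :=
  ad_sq_le_after' hY hV hR hT hT'T hT'2 hK hML hMK hε hεle h0
    (budget_le_eighth hK hML hMK hε hεle hη) hτ1 hcτ hbτ hd hon hfit ht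

/-- **(able) for approximate trajectories**: on `[t' + 1/√K, T']` (`t' = τ + d + 1/K`),
`|ã - 1| ≤ 4K⁻²⁰` and `|a|, |b|, |c|, |d| ≤ 2K⁻¹⁰`. [cite: Tao2016AveragedNS, §5.5 (able)] -/
theorem fired_after (hfit : τ + d + K⁻¹ ≤ T') {t : ℝ}
    (ht : t ∈ Icc (τ + d + K⁻¹ + (Real.sqrt K)⁻¹) T') :
    |Y t 4 - 1| ≤ 4 / K ^ 20 ∧ ∀ i : Fin 5, i ≠ 4 → |Y t i| ≤ 2 / K ^ 10 :=
  fired_after' hY hV hR hT hT'T hT'2 hK hML hMK hε hεle h0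
    (budget_le_eighth hK hML hMK hε hεle hη) hτ1 hcτ hbτ hd hon hfit ht

end Onset

end Entry

end Seed

end Late

end Approx

/-- Closure at the right end point: a continuous `g` with `g ≤ c` on `[a, 2)`, `a < 2`, has
`g(2) ≤ c`. [folklore] -/
theorem le_at_two_of_Ico {g : ℝ → ℝ} (hg : Continuous g) {a c : ℝ} (ha : a < 2)
    (h : ∀ t ∈ Ico a 2, g t ≤ c) : g 2 ≤ c := by
  have hS : IsClosed {t | g t ≤ c} := isClosed_le hg continuous_const
  have hsub : closure (Ico a 2) ⊆ {t | g t ≤ c} := closure_minimal (fun t ht => h t ht) hS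
  rw [closure_Ico ha.ne] at hsub
  exact hsub ⟨ha.le, le_rfl⟩

end Ignition

/-! ## §4. Exported statements: Theorem 5.3 for approximate trajectories at the seed scale -/

/-- **The gate fires along every differentiable approximate trajectory within the seed-scale
budget (explicit hypotheses).** For every member `delayCircuitWith K M ε` under the standing
hypotheses and every differentiable approximate trajectory `Y` (velocity `V`, sup-defect `≤ δ` and
sup-norm `≤ 2` on `[0,T)`, `T ≥ 2`) issued `δ₀`-close to Tao's datum (5.6) with
`δ₀ + δT ≤ ε²e^{-M}/(8√M)`: there is a trigger time `τ ∈ (1, 8/5]` (first hitting time of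
`c = ε²/K¹⁰`; the output is quiet, `|ã| ≤ 4K⁻¹⁰`, on `[0, τ]`), and with `d = 130 log K/M`,
`t' = τ + d + 1/K`: on every late window `[t' + 1/√K, T']` (`T' < T`, `T' ≤ 2`, `t' ≤ T'`) the
trajectory is in the fired state `|ã - 1| ≤ 4K⁻²⁰`, `|a|, |b|, |c|, |d| ≤ 2K⁻¹⁰`; and
`t' + 1/√K < 7/4`. [cite: Tao2016AveragedNS, §5.5 Theorem 5.3] -/
theorem approxTrajectory_fires (K M ε δ δ₀ T : ℝ) (Y V : ℝ → Fin 5 → ℝ)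
    (hK : 2 * 20 ^ 42 * (Nat.factorial 42 : ℝ) + 16 ≤ K) (hML : 3000 * Real.log K ≤ M)
    (hMK : M ≤ K ^ 10) (hε : 0 < ε) (hεle : ε ≤ exp (-(10 * M)) / K ^ 100) (hT : 2 ≤ T)
    (hY : ∀ t, HasDerivAt Y (V t) t)
    (hV : ∀ t ∈ Ico 0 T, ‖V t - delayCircuitWith K M ε (Y t)‖ ≤ δ)
    (hR : ∀ t ∈ Ico 0 T, ‖Y t‖ ≤ 2) (h0 : ‖Y 0 - delayInit‖ ≤ δ₀)
    (hB : δ₀ + δ * T ≤ ε ^ 2 * exp (-M) / (8 * Real.sqrt M)) :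
    ∃ τ ∈ Ioc (1 : ℝ) (8 / 5), Y τ 2 = ε ^ 2 / K ^ 10 ∧
      (∀ t ∈ Ico (0 : ℝ) τ, |Y t 2| < ε ^ 2 / K ^ 10) ∧
      (∀ t ∈ Icc (0 : ℝ) τ, |Y t 4| ≤ 4 / K ^ 10) ∧
      τ + 130 * Real.log K / M + K⁻¹ + (Real.sqrt K)⁻¹ < 7 / 4 ∧
      ∀ T', T' < T → T' ≤ 2 → τ + 130 * Real.log K / M + K⁻¹ ≤ T' →
        ∀ t ∈ Icc (τ + 130 * Real.log K / M + K⁻¹ + (Real.sqrt K)⁻¹) T',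
          |Y t 4 - 1| ≤ 4 / K ^ 20 ∧ ∀ i : Fin 5, i ≠ 4 → |Y t i| ≤ 2 / K ^ 10 := by
  have hδ : 0 ≤ δ := Ignition.defect_nonneg hV hT
  have hη : δ₀ + 2 * δ ≤ ε ^ 2 * exp (-M) / (8 * Real.sqrt M) := by nlinarith
  obtain ⟨τ, hτ, hcτ, hbefore, -, hblate, hwin⟩ :=
    Ignition.exists_triggerLevel_hit hY hV hR hT hK hML hMK hε hεle h0 hη
  have hbτ : 49 / 50 * ε ≤ Y τ 1 := hblate τ ⟨hτ.1.le, le_rfl⟩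
  obtain ⟨-, hon, hd0, hd20⟩ := Ignition.transition_params hK hML hMK hε hεle
  obtain ⟨-, -, -, -, hs20, hKinv, -, -⟩ :=
    Ignition.firing_params hV hT hK hML hMK hε hεle h0 hη
  have hfit2 : τ + 130 * Real.log K / M + K⁻¹ + (Real.sqrt K)⁻¹ < 7 / 4 := by linarith [hτ.2]
  refine ⟨τ, hτ, hcτ, hbefore, fun t ht => (hwin t ht).2.2.2, hfit2,
    fun T' hT'T hT'2 hfit t ht => ?_⟩
  exact Ignition.fired_after hY hV hR hT hT'T hT'2 hK hML hMK hε hεle h0 hη hτ.1 hcτ hbτ hd0 hon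
    hfit ht

/-- **Fired at the cycle time.** Under the hypotheses of `approxTrajectory_fires`, the trajectory
is in the fired state `|ã - 1| ≤ 4K⁻²⁰`, `|a|, |b|, |c|, |d| ≤ 2K⁻¹⁰` at every `t ∈ [7/4, 2]`
(for `t < 2` by the previous theorem with `T' = t`; at `t = 2` by continuity, also when `T = 2`).
This is [Tao2016AveragedNS, Theorem 5.3] for differentiable approximate trajectories within the
seed-scale budget. [cite: Tao2016AveragedNS, §5.5 Theorem 5.3] -/
theorem approxTrajectory_fired_at_two (K M ε δ δ₀ T : ℝ) (Y V : ℝ → Fin 5 → ℝ)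
    (hK : 2 * 20 ^ 42 * (Nat.factorial 42 : ℝ) + 16 ≤ K) (hML : 3000 * Real.log K ≤ M)
    (hMK : M ≤ K ^ 10) (hε : 0 < ε) (hεle : ε ≤ exp (-(10 * M)) / K ^ 100) (hT : 2 ≤ T)
    (hY : ∀ t, HasDerivAt Y (V t) t)
    (hV : ∀ t ∈ Ico 0 T, ‖V t - delayCircuitWith K M ε (Y t)‖ ≤ δ)
    (hR : ∀ t ∈ Ico 0 T, ‖Y t‖ ≤ 2) (h0 : ‖Y 0 - delayInit‖ ≤ δ₀)
    (hB : δ₀ + δ * T ≤ ε ^ 2 * exp (-M) / (8 * Real.sqrt M)) :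
    ∀ t ∈ Icc (7 / 4 : ℝ) 2, |Y t 4 - 1| ≤ 4 / K ^ 20 ∧ ∀ i : Fin 5, i ≠ 4 → |Y t i| ≤ 2 / K ^ 10 := by
  obtain ⟨τ, hτ, -, -, -, hfit2, hlate⟩ :=
    approxTrajectory_fires K M ε δ δ₀ T Y V hK hML hMK hε hεle hT hY hV hR h0 hB
  obtain ⟨-, -, -, -, hs20, hKinv, -, -⟩ :=
    Ignition.firing_params hV hT hK hML hMK hε hεle h0 (by
      have hδ : 0 ≤ δ := Ignition.defect_nonneg hV hT
      nlinarith)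
  have hK16 := (negKick_params hK hML hMK hε hεle).1
  have hsq0 := (Thm53.invSqrt_facts hK16).1
  -- the open part `[7/4, 2)`
  have hIco : ∀ t ∈ Ico (7 / 4 : ℝ) 2,
      |Y t 4 - 1| ≤ 4 / K ^ 20 ∧ ∀ i : Fin 5, i ≠ 4 → |Y t i| ≤ 2 / K ^ 10 := by
    intro t ht
    exact hlate t (by linarith [ht.2]) ht.2.le (by linarith [ht.1, hsq0]) t
      ⟨by linarith [ht.1], le_rfl⟩
  intro t ht
  rcases lt_or_eq_of_le ht.2 with h2 | h2
  · exact hIco t ⟨ht.1, h2⟩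
  · subst h2
    have h74 : (7 / 4 : ℝ) < 2 := by norm_num
    refine ⟨?_, fun i hi => ?_⟩
    · exact Ignition.le_at_two_of_Ico
        (((Ignition.continuous_coord hY 4).sub continuous_const).abs) h74
        (fun s hs => (hIco s hs).1)
    · exact Ignition.le_at_two_of_Ico ((Ignition.continuous_coord hY i).abs) h74
        (fun s hs => (hIco s hs).2 i hi)

end Literature.Analysis.FluidPDE.Tao2016AveragedNS
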